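import Mathlib

/-!
# Nodal propagator decay (route `NodalWardXY`, item `NodalPropagatorDecay`): I. the one-variable profile

Along a momentum line `p₂ = const`, the d-wave BdG data `(ξ, Δ)` move on a straight line of the
`(ξ, Δ)`-plane, so every Nambu component of `e^{-|τ|E} (1, ξ/E, Δ/E)` is the composition of
`p₁ ↦ a cos p₁ + b` with ONE universal profile
`prof⟪l, α, β, γ, s⟫ = e^{-l ρ(s)} (γ + (α + β s)/ρ(s))`, `ρ(s) = √(1+s²)`,
with `l = |τ|·dist(line, 0) ≥ 0` and `|α|, |β|, |γ| ≤ 1`.  This file records the profile, its first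
three derivatives in closed form (`prof1`, `prof2`, `prof3`, via `HasDerivAt`), and the pointwise
bounds `|prof⁽ᵏ⁾(s)| ≤ c_k · ((l + l² + l³) e^{-lρ} + 1/ρ²)`, whose right-hand side is integrable on
`ℝ` uniformly in `l ≥ 0` (file II turns this into Fourier decay).  Pure calculus; no physics.
-/

noncomputable section

namespace Summit.HubbardSuperconductivity.HubbardSuperconductivity.Theorems

namespace NodalDecay

open Real

/-! ### Notation (local; every file of this proof re-declares the same abbreviations)

No definitions are introduced: `ρ⟪s⟫ = √(1+s²)`, `θ = s/ρ`, `θ1 = 1/ρ³`, `θ2 = -3s/ρ⁵`,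
`P0⟪l,s⟫ = e^{-lρ}` with its derivatives `P1, P2, P3`, `Q0⟪α,β,γ,s⟫ = γ + (α+βs)/ρ` with its
derivatives `Q1, Q2, Q3` are LOCAL NOTATIONS for explicit closed terms. -/

local notation "ρ⟪" s "⟫" => Real.sqrt (1 + s ^ 2)
local notation "θ⟪" s "⟫" => s / ρ⟪s⟫
local notation "θ1⟪" s "⟫" => 1 / ρ⟪s⟫ ^ 3
local notation "θ2⟪" s "⟫" => -3 * s / ρ⟪s⟫ ^ 5
local notation "P0⟪" l ", " s "⟫" => Real.exp (-(l * ρ⟪s⟫))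
local notation "P1⟪" l ", " s "⟫" => -l * θ⟪s⟫ * P0⟪l, s⟫
local notation "P2⟪" l ", " s "⟫" => (-l * θ1⟪s⟫ + l ^ 2 * θ⟪s⟫ ^ 2) * P0⟪l, s⟫
local notation "P3⟪" l ", " s "⟫" =>
  (-l * θ2⟪s⟫ + 3 * l ^ 2 * θ⟪s⟫ * θ1⟪s⟫ - l ^ 3 * θ⟪s⟫ ^ 3) * P0⟪l, s⟫
local notation "Q0⟪" α ", " β ", " γ ", " s "⟫" => γ + (α + β * s) / ρ⟪s⟫
local notation "Q1⟪" α ", " β ", " s "⟫" => (β - α * s) / ρ⟪s⟫ ^ 3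
local notation "Q2⟪" α ", " β ", " s "⟫" => -α / ρ⟪s⟫ ^ 3 - 3 * s * (β - α * s) / ρ⟪s⟫ ^ 5
local notation "Q3⟪" α ", " β ", " s "⟫" =>
  (9 * α * s - 3 * β) / ρ⟪s⟫ ^ 5 + 15 * s ^ 2 * (β - α * s) / ρ⟪s⟫ ^ 7
local notation "prof⟪" l ", " α ", " β ", " γ ", " s "⟫" => P0⟪l, s⟫ * Q0⟪α, β, γ, s⟫
local notation "prof1⟪" l ", " α ", " β ", " γ ", " s "⟫" =>
  P1⟪l, s⟫ * Q0⟪α, β, γ, s⟫ + P0⟪l, s⟫ * Q1⟪α, β, s⟫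
local notation "prof2⟪" l ", " α ", " β ", " γ ", " s "⟫" =>
  P2⟪l, s⟫ * Q0⟪α, β, γ, s⟫ + 2 * (P1⟪l, s⟫ * Q1⟪α, β, s⟫) + P0⟪l, s⟫ * Q2⟪α, β, s⟫
local notation "prof3⟪" l ", " α ", " β ", " γ ", " s "⟫" =>
  P3⟪l, s⟫ * Q0⟪α, β, γ, s⟫ + 3 * (P2⟪l, s⟫ * Q1⟪α, β, s⟫) + 3 * (P1⟪l, s⟫ * Q2⟪α, β, s⟫)
    + P0⟪l, s⟫ * Q3⟪α, β, s⟫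
local notation "maj⟪" l ", " s "⟫" => (l + l ^ 2 + l ^ 3) * P0⟪l, s⟫ + 1 / ρ⟪s⟫ ^ 2

/-! ### `ρ(s) = √(1+s²)` and `θ(s) = s/ρ(s)` -/

/-- `ρ > 0`. -/
theorem rho_pos (s : ℝ) : 0 < ρ⟪s⟫ := Real.sqrt_pos.2 (by positivity)

/-- `ρ² = 1 + s²`. -/
theorem rho_sq (s : ℝ) : ρ⟪s⟫ ^ 2 = 1 + s ^ 2 := Real.sq_sqrt (by positivity)

/-- `1 ≤ ρ`. -/
theorem one_le_rho (s : ℝ) : 1 ≤ ρ⟪s⟫ := by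
  have h := rho_sq s
  nlinarith [rho_pos s, sq_nonneg s]

/-- `|s| ≤ ρ(s)`. -/
theorem abs_le_rho (s : ℝ) : |s| ≤ ρ⟪s⟫ := by
  rw [← Real.sqrt_sq_eq_abs]
  exact Real.sqrt_le_sqrt (by linarith)

/-- `s² ≤ ρ(s)²`. -/
theorem sq_le_rho_sq (s : ℝ) : s ^ 2 ≤ ρ⟪s⟫ ^ 2 := by
  rw [rho_sq]; linarith

/-- `(1 + |s|)/2 ≤ ρ(s)`. -/
theorem half_one_add_abs_le_rho (s : ℝ) : (1 + |s|) / 2 ≤ ρ⟪s⟫ := by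
  have := one_le_rho s; have := abs_le_rho s; linarith

/-- `ρ' = s/ρ`. -/
theorem hasDerivAt_rho (s : ℝ) : HasDerivAt (fun x => ρ⟪x⟫) (s / ρ⟪s⟫) s := by
  have h : HasDerivAt (fun x : ℝ => 1 + x ^ 2) (2 * s) s := by
    simpa using ((hasDerivAt_pow 2 s).const_add 1)
  have hne : (1 + s ^ 2) ≠ 0 := by positivity
  refine (h.sqrt hne).congr_deriv ?_
  field_simp

/-- `(ρ³)' = 3 s ρ`. -/
theorem hasDerivAt_rho_pow_three (s : ℝ) : HasDerivAt (fun x => ρ⟪x⟫ ^ 3) (3 * s * ρ⟪s⟫) s := by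
  refine ((hasDerivAt_rho s).fun_pow 3).congr_deriv ?_
  have hρ : ρ⟪s⟫ ≠ 0 := (rho_pos s).ne'
  norm_num
  field_simp

/-- `(ρ⁵)' = 5 s ρ³`. -/
theorem hasDerivAt_rho_pow_five (s : ℝ) :
    HasDerivAt (fun x => ρ⟪x⟫ ^ 5) (5 * s * ρ⟪s⟫ ^ 3) s := by
  refine ((hasDerivAt_rho s).fun_pow 5).congr_deriv ?_
  have hρ : ρ⟪s⟫ ≠ 0 := (rho_pos s).ne'
  norm_num
  field_simp

/-- `ρ` is continuous. -/
theorem continuous_rho : Continuous fun x => ρ⟪x⟫ := by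
  fun_prop

/-- `θ' = θ₁` (uses `ρ² = 1 + s²`). -/
theorem hasDerivAt_th (s : ℝ) : HasDerivAt (fun x => θ⟪x⟫) (θ1⟪s⟫) s := by
  refine ((hasDerivAt_id' s).fun_div (hasDerivAt_rho s) (rho_pos s).ne').congr_deriv ?_
  have hρ : ρ⟪s⟫ ≠ 0 := (rho_pos s).ne'
  have h2 := rho_sq s
  field_simp
  nlinarith [h2]

/-- `θ₁' = θ₂`. -/
theorem hasDerivAt_th1 (s : ℝ) : HasDerivAt (fun x => θ1⟪x⟫) (θ2⟪s⟫) s := by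
  have hρ : ρ⟪s⟫ ≠ 0 := (rho_pos s).ne'
  refine ((hasDerivAt_const s (1:ℝ)).fun_div (hasDerivAt_rho_pow_three s)
    (pow_ne_zero 3 hρ)).congr_deriv ?_
  field_simp
  ring

/-- `|θ| ≤ 1`. -/
theorem abs_th_le (s : ℝ) : |θ⟪s⟫| ≤ 1 := by
  rw [abs_div, abs_of_pos (rho_pos s), div_le_one (rho_pos s)]
  exact abs_le_rho s

/-- `|θ₁| ≤ 1`. -/
theorem abs_th1_le (s : ℝ) : |θ1⟪s⟫| ≤ 1 := by
  have h1 := one_le_rho s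
  rw [abs_of_pos (by positivity), div_le_one (by positivity)]
  exact one_le_pow₀ h1

/-- `|θ₂| ≤ 3`. -/
theorem abs_th2_le (s : ℝ) : |θ2⟪s⟫| ≤ 3 := by
  have h1 := one_le_rho s
  have hs := abs_le_rho s
  have hρ := rho_pos s
  rw [abs_div, abs_of_pos (by positivity : (0:ℝ) < ρ⟪s⟫ ^ 5), div_le_iff₀ (by positivity),
    abs_mul, abs_neg, show |(3:ℝ)| = 3 by norm_num]
  have h4 : 1 ≤ ρ⟪s⟫ ^ 4 := one_le_pow₀ h1
  calc 3 * |s| ≤ 3 * ρ⟪s⟫ := by nlinarith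
    _ = 3 * (ρ⟪s⟫ * 1) := by ring
    _ ≤ 3 * (ρ⟪s⟫ * ρ⟪s⟫ ^ 4) := by gcongr
    _ = 3 * ρ⟪s⟫ ^ 5 := by ring

/-! ### The exponential factor `P₀ = e^{-lρ}` and its derivatives -/

/-- `P₀ > 0`. -/
theorem P0_pos (l s : ℝ) : 0 < P0⟪l, s⟫ := Real.exp_pos _

/-- `P₀ ≤ 1` for `l ≥ 0`. -/
theorem P0_le_one {l : ℝ} (hl : 0 ≤ l) (s : ℝ) : P0⟪l, s⟫ ≤ 1 := by
  rw [Real.exp_le_one_iff]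
  have := rho_pos s
  nlinarith

/-- `P₀' = P₁`. -/
theorem hasDerivAt_P0 (l s : ℝ) : HasDerivAt (fun x => P0⟪l, x⟫) (P1⟪l, s⟫) s := by
  refine (((hasDerivAt_rho s).const_mul l).fun_neg.exp).congr_deriv ?_
  ring

/-- `P₁' = P₂`. -/
theorem hasDerivAt_P1 (l s : ℝ) : HasDerivAt (fun x => P1⟪l, x⟫) (P2⟪l, s⟫) s := by
  refine ((((hasDerivAt_th s).const_mul (-l))).fun_mul (hasDerivAt_P0 l s)).congr_deriv ?_
  ring

/-- `P₂' = P₃`. -/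
theorem hasDerivAt_P2 (l s : ℝ) : HasDerivAt (fun x => P2⟪l, x⟫) (P3⟪l, s⟫) s := by
  refine (((((hasDerivAt_th1 s).const_mul (-l))).fun_add
    (((hasDerivAt_th s).fun_pow 2).const_mul (l ^ 2))).fun_mul (hasDerivAt_P0 l s)).congr_deriv ?_
  norm_num
  ring

/-- `|P₁| ≤ l P₀`. -/
theorem abs_P1_le {l : ℝ} (hl : 0 ≤ l) (s : ℝ) : |P1⟪l, s⟫| ≤ l * P0⟪l, s⟫ := by
  rw [abs_mul, abs_mul, abs_neg, abs_of_nonneg hl, abs_of_pos (P0_pos l s)]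
  have := abs_th_le s
  have := P0_pos l s
  calc l * |θ⟪s⟫| * P0⟪l, s⟫ ≤ l * 1 * P0⟪l, s⟫ := by gcongr
    _ = l * P0⟪l, s⟫ := by ring

/-- `|P₂| ≤ (l + l²) P₀`. -/
theorem abs_P2_le {l : ℝ} (hl : 0 ≤ l) (s : ℝ) : |P2⟪l, s⟫| ≤ (l + l ^ 2) * P0⟪l, s⟫ := by
  rw [abs_mul, abs_of_pos (P0_pos l s)]
  have hP := P0_pos l s
  gcongr
  have h1 := abs_th_le s
  have h2 := abs_th1_le s
  calc |(-l * θ1⟪s⟫ + l ^ 2 * θ⟪s⟫ ^ 2)| ≤ |-l * θ1⟪s⟫| + |l ^ 2 * θ⟪s⟫ ^ 2| := abs_add_le _ _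
    _ = l * |θ1⟪s⟫| + l ^ 2 * |θ⟪s⟫| ^ 2 := by
        rw [abs_mul, abs_mul, abs_neg, abs_pow, abs_pow, abs_of_nonneg hl]
    _ ≤ l * 1 + l ^ 2 * 1 ^ 2 := by gcongr
    _ = l + l ^ 2 := by ring

/-- `|P₃| ≤ (3l + 3l² + l³) P₀`. -/
theorem abs_P3_le {l : ℝ} (hl : 0 ≤ l) (s : ℝ) :
    |P3⟪l, s⟫| ≤ (3 * l + 3 * l ^ 2 + l ^ 3) * P0⟪l, s⟫ := by
  rw [abs_mul, abs_of_pos (P0_pos l s)]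
  have hP := P0_pos l s
  gcongr
  have h0 := abs_th_le s
  have h1 := abs_th1_le s
  have h2 := abs_th2_le s
  have hA : |-l * θ2⟪s⟫| ≤ 3 * l := by
    rw [abs_mul, abs_neg, abs_of_nonneg hl]
    calc l * |θ2⟪s⟫| ≤ l * 3 := by gcongr
      _ = 3 * l := by ring
  have hB : |3 * l ^ 2 * θ⟪s⟫ * θ1⟪s⟫| ≤ 3 * l ^ 2 := by
    rw [abs_mul, abs_mul, abs_mul, show |(3:ℝ)| = 3 by norm_num, abs_of_nonneg (by positivity : (0:ℝ) ≤ l ^ 2)]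
    calc 3 * l ^ 2 * |θ⟪s⟫| * |θ1⟪s⟫| ≤ 3 * l ^ 2 * 1 * 1 := by gcongr
      _ = 3 * l ^ 2 := by ring
  have hC : |l ^ 3 * θ⟪s⟫ ^ 3| ≤ l ^ 3 := by
    rw [abs_mul, abs_pow, abs_pow, abs_of_nonneg hl]
    calc l ^ 3 * |θ⟪s⟫| ^ 3 ≤ l ^ 3 * 1 ^ 3 := by gcongr
      _ = l ^ 3 := by ring
  calc |(-l * θ2⟪s⟫ + 3 * l ^ 2 * θ⟪s⟫ * θ1⟪s⟫ - l ^ 3 * θ⟪s⟫ ^ 3)|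
      ≤ |-l * θ2⟪s⟫ + 3 * l ^ 2 * θ⟪s⟫ * θ1⟪s⟫| + |l ^ 3 * θ⟪s⟫ ^ 3| := abs_sub _ _
    _ ≤ (|-l * θ2⟪s⟫| + |3 * l ^ 2 * θ⟪s⟫ * θ1⟪s⟫|) + |l ^ 3 * θ⟪s⟫ ^ 3| := by
        gcongr; exact abs_add_le _ _
    _ ≤ (3 * l + 3 * l ^ 2) + l ^ 3 := by gcongr
    _ = 3 * l + 3 * l ^ 2 + l ^ 3 := by ring

/-! ### The algebraic factor `Q₀ = γ + (α + βs)/ρ` and its derivatives -/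

/-- `Q₀' = Q₁` (uses `ρ² = 1 + s²`). -/
theorem hasDerivAt_Q0 (α β γ s : ℝ) : HasDerivAt (fun x => Q0⟪α, β, γ, x⟫) (Q1⟪α, β, s⟫) s := by
  have hρ := rho_pos s
  have hlin : HasDerivAt (fun x : ℝ => α + β * x) β s := by
    simpa using ((hasDerivAt_id s).const_mul β).const_add α
  refine ((hlin.fun_div (hasDerivAt_rho s) hρ.ne').const_add γ).congr_deriv ?_
  have h2 := rho_sq s
  have hρ' : ρ⟪s⟫ ≠ 0 := hρ.ne'
  field_simp
  linear_combination β * h2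

/-- `Q₁' = Q₂`. -/
theorem hasDerivAt_Q1 (α β s : ℝ) : HasDerivAt (fun x => Q1⟪α, β, x⟫) (Q2⟪α, β, s⟫) s := by
  have hρ := rho_pos s
  have hlin : HasDerivAt (fun x : ℝ => β - α * x) (-α) s := by
    simpa using ((hasDerivAt_id s).const_mul α).const_sub β
  have hρ' : ρ⟪s⟫ ≠ 0 := hρ.ne'
  refine (hlin.fun_div (hasDerivAt_rho_pow_three s) (pow_ne_zero 3 hρ')).congr_deriv ?_
  field_simp

/-- `Q₂' = Q₃`. -/
theorem hasDerivAt_Q2 (α β s : ℝ) : HasDerivAt (fun x => Q2⟪α, β, x⟫) (Q3⟪α, β, s⟫) s := by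
  have hρ := rho_pos s
  have hρ' : ρ⟪s⟫ ≠ 0 := hρ.ne'
  have hA := (hasDerivAt_const s (-α)).fun_div (hasDerivAt_rho_pow_three s) (pow_ne_zero 3 hρ')
  have h1 : HasDerivAt (fun x : ℝ => 3 * x) (3 * 1) s := (hasDerivAt_id' s).const_mul 3
  have h2 : HasDerivAt (fun x : ℝ => β - α * x) (-α) s := by
    simpa using ((hasDerivAt_id s).const_mul α).const_sub β
  have hB := (h1.fun_mul h2).fun_div (hasDerivAt_rho_pow_five s) (pow_ne_zero 5 hρ')
  refine (hA.fun_sub hB).congr_deriv ?_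
  field_simp
  ring

/-- `|Q₀| ≤ 3` when `|α|, |β|, |γ| ≤ 1`. -/
theorem abs_Q0_le {α β γ : ℝ} (hα : |α| ≤ 1) (hβ : |β| ≤ 1) (hγ : |γ| ≤ 1) (s : ℝ) :
    |Q0⟪α, β, γ, s⟫| ≤ 3 := by
  have hρ := rho_pos s
  have h1 := one_le_rho s
  have hs := abs_le_rho s
  have hfrac : |(α + β * s) / ρ⟪s⟫| ≤ 2 := by
    rw [abs_div, abs_of_pos hρ, div_le_iff₀ hρ]
    calc |α + β * s| ≤ |α| + |β * s| := abs_add_le _ _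
      _ = |α| + |β| * |s| := by rw [abs_mul]
      _ ≤ 1 + 1 * ρ⟪s⟫ := by gcongr
      _ ≤ 2 * ρ⟪s⟫ := by linarith
  calc |γ + (α + β * s) / ρ⟪s⟫| ≤ |γ| + |(α + β * s) / ρ⟪s⟫| := abs_add_le _ _
    _ ≤ 1 + 2 := by gcongr
    _ = 3 := by norm_num

/-- `|β - αs| ≤ 2ρ` when `|α|, |β| ≤ 1`. -/
theorem abs_lin_le {α β : ℝ} (hα : |α| ≤ 1) (hβ : |β| ≤ 1) (s : ℝ) :
    |β - α * s| ≤ 2 * ρ⟪s⟫ := by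
  have h1 := one_le_rho s
  have hs := abs_le_rho s
  calc |β - α * s| ≤ |β| + |α * s| := abs_sub _ _
    _ = |β| + |α| * |s| := by rw [abs_mul]
    _ ≤ 1 + 1 * ρ⟪s⟫ := by gcongr
    _ ≤ 2 * ρ⟪s⟫ := by linarith

/-- `|Q₁| ≤ 2/ρ²` when `|α|, |β| ≤ 1`. -/
theorem abs_Q1_le {α β : ℝ} (hα : |α| ≤ 1) (hβ : |β| ≤ 1) (s : ℝ) :
    |Q1⟪α, β, s⟫| ≤ 2 / ρ⟪s⟫ ^ 2 := by
  have hρ := rho_pos s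
  rw [abs_div, abs_of_pos (by positivity : (0:ℝ) < ρ⟪s⟫ ^ 3),
    div_le_div_iff₀ (by positivity) (by positivity)]
  have hn := abs_lin_le hα hβ s
  calc |β - α * s| * ρ⟪s⟫ ^ 2 ≤ (2 * ρ⟪s⟫) * ρ⟪s⟫ ^ 2 := by gcongr
    _ = 2 * ρ⟪s⟫ ^ 3 := by ring

/-- `|Q₂| ≤ 7/ρ²` when `|α|, |β| ≤ 1`. -/
theorem abs_Q2_le {α β : ℝ} (hα : |α| ≤ 1) (hβ : |β| ≤ 1) (s : ℝ) :
    |Q2⟪α, β, s⟫| ≤ 7 / ρ⟪s⟫ ^ 2 := by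
  have hρ := rho_pos s
  have h1 := one_le_rho s
  have hs := abs_le_rho s
  have hA : |-α / ρ⟪s⟫ ^ 3| ≤ 1 / ρ⟪s⟫ ^ 2 := by
    rw [abs_div, abs_neg, abs_of_pos (by positivity : (0:ℝ) < ρ⟪s⟫ ^ 3),
      div_le_div_iff₀ (by positivity) (by positivity)]
    calc |α| * ρ⟪s⟫ ^ 2 ≤ 1 * ρ⟪s⟫ ^ 2 := by gcongr
      _ = ρ⟪s⟫ ^ 2 * 1 := by ring
      _ ≤ ρ⟪s⟫ ^ 2 * ρ⟪s⟫ := by gcongr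
      _ = 1 * ρ⟪s⟫ ^ 3 := by ring
  have hB : |3 * s * (β - α * s) / ρ⟪s⟫ ^ 5| ≤ 6 / ρ⟪s⟫ ^ 2 := by
    rw [abs_div, abs_of_pos (by positivity : (0:ℝ) < ρ⟪s⟫ ^ 5),
      div_le_div_iff₀ (by positivity) (by positivity)]
    have hn := abs_lin_le hα hβ s
    calc |3 * s * (β - α * s)| * ρ⟪s⟫ ^ 2 = 3 * |s| * |β - α * s| * ρ⟪s⟫ ^ 2 := by
          rw [abs_mul, abs_mul, show |(3:ℝ)| = 3 by norm_num]
      _ ≤ 3 * ρ⟪s⟫ * (2 * ρ⟪s⟫) * ρ⟪s⟫ ^ 2 := by gcongr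
      _ = 6 * ρ⟪s⟫ ^ 4 * 1 := by ring
      _ ≤ 6 * ρ⟪s⟫ ^ 4 * ρ⟪s⟫ := by gcongr
      _ = 6 * ρ⟪s⟫ ^ 5 := by ring
  calc |-α / ρ⟪s⟫ ^ 3 - 3 * s * (β - α * s) / ρ⟪s⟫ ^ 5|
      ≤ |-α / ρ⟪s⟫ ^ 3| + |3 * s * (β - α * s) / ρ⟪s⟫ ^ 5| := abs_sub _ _
    _ ≤ 1 / ρ⟪s⟫ ^ 2 + 6 / ρ⟪s⟫ ^ 2 := add_le_add hA hB
    _ = 7 / ρ⟪s⟫ ^ 2 := by ring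

/-- `|Q₃| ≤ 42/ρ²` when `|α|, |β| ≤ 1`. -/
theorem abs_Q3_le {α β : ℝ} (hα : |α| ≤ 1) (hβ : |β| ≤ 1) (s : ℝ) :
    |Q3⟪α, β, s⟫| ≤ 42 / ρ⟪s⟫ ^ 2 := by
  have hρ := rho_pos s
  have h1 := one_le_rho s
  have hs := abs_le_rho s
  have hA : |(9 * α * s - 3 * β) / ρ⟪s⟫ ^ 5| ≤ 12 / ρ⟪s⟫ ^ 2 := by
    rw [abs_div, abs_of_pos (by positivity : (0:ℝ) < ρ⟪s⟫ ^ 5),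
      div_le_div_iff₀ (by positivity) (by positivity)]
    have hn : |9 * α * s - 3 * β| ≤ 12 * ρ⟪s⟫ := by
      calc |9 * α * s - 3 * β| ≤ |9 * α * s| + |3 * β| := abs_sub _ _
        _ = 9 * |α| * |s| + 3 * |β| := by
            rw [abs_mul, abs_mul, abs_mul, show |(9:ℝ)| = 9 by norm_num,
              show |(3:ℝ)| = 3 by norm_num]
        _ ≤ 9 * 1 * ρ⟪s⟫ + 3 * 1 := by gcongr
        _ ≤ 12 * ρ⟪s⟫ := by linarith
    have h3 : (1:ℝ) ≤ ρ⟪s⟫ ^ 2 := one_le_pow₀ h1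
    calc |9 * α * s - 3 * β| * ρ⟪s⟫ ^ 2 ≤ 12 * ρ⟪s⟫ * ρ⟪s⟫ ^ 2 := by gcongr
      _ = 12 * ρ⟪s⟫ ^ 3 * 1 := by ring
      _ ≤ 12 * ρ⟪s⟫ ^ 3 * ρ⟪s⟫ ^ 2 := by gcongr
      _ = 12 * ρ⟪s⟫ ^ 5 := by ring
  have hB : |15 * s ^ 2 * (β - α * s) / ρ⟪s⟫ ^ 7| ≤ 30 / ρ⟪s⟫ ^ 2 := by
    rw [abs_div, abs_of_pos (by positivity : (0:ℝ) < ρ⟪s⟫ ^ 7),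
      div_le_div_iff₀ (by positivity) (by positivity)]
    have hn := abs_lin_le hα hβ s
    have hs2 : s ^ 2 ≤ ρ⟪s⟫ ^ 2 := sq_le_rho_sq s
    have h2 : (1:ℝ) ≤ ρ⟪s⟫ ^ 2 := one_le_pow₀ h1
    calc |15 * s ^ 2 * (β - α * s)| * ρ⟪s⟫ ^ 2 = 15 * s ^ 2 * |β - α * s| * ρ⟪s⟫ ^ 2 := by
          rw [abs_mul, abs_mul, show |(15:ℝ)| = 15 by norm_num, abs_of_nonneg (sq_nonneg s)]
      _ ≤ 15 * ρ⟪s⟫ ^ 2 * (2 * ρ⟪s⟫) * ρ⟪s⟫ ^ 2 := by gcongr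
      _ = 30 * ρ⟪s⟫ ^ 5 * 1 := by ring
      _ ≤ 30 * ρ⟪s⟫ ^ 5 * ρ⟪s⟫ ^ 2 := by gcongr
      _ = 30 * ρ⟪s⟫ ^ 7 := by ring
  calc |(9 * α * s - 3 * β) / ρ⟪s⟫ ^ 5 + 15 * s ^ 2 * (β - α * s) / ρ⟪s⟫ ^ 7|
      ≤ |(9 * α * s - 3 * β) / ρ⟪s⟫ ^ 5| + |15 * s ^ 2 * (β - α * s) / ρ⟪s⟫ ^ 7| :=
        abs_add_le _ _
    _ ≤ 12 / ρ⟪s⟫ ^ 2 + 30 / ρ⟪s⟫ ^ 2 := add_le_add hA hB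
    _ = 42 / ρ⟪s⟫ ^ 2 := by ring

end NodalDecay

end Summit.HubbardSuperconductivity.HubbardSuperconductivity.Theorems
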